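import Mathlib
import Summits.Ventures.HodgeRepro2.FaceData
import Summits.Ventures.HodgeRepro2.T5DatumAssembly
import Summits.Ventures.HodgeRepro2.T5CMFrameDictionary

/-!
# T5N2DatumExistence — the EX class of the N2 datum: a CM frame, two generating sign elements and
the similitude scalar EXIST for every sextic CM field (support, seat p3, gen 23)

TIER5 (N0.3)(b) / §N2.1(b) (route/T5-N2-route-3.md, merged TIER5 ll. 259–296) takes as its datum a
CM frame `τ = (τ₁, τ₂, τ₃)` of the sextic CM field `E = K`, two generating sign elements
`e₁₁₁, e₁₀₀ ∈ E^{×,−}` that are μ-admissible (Liu Def. 4.12 = `IsLiuSignElement`) for the vertex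
types `T₁₁₁ = {τ₁, τ₂, τ₃}` and `T₁₀₀ = {τ₁, τ̄₂, τ̄₃}`, and a totally real similitude scalar `u`
with signs `(+, −, +)` such that `e₁₀₁ := u·e₁₁₁`, `e₁₁₀ := u⁻¹·e₁₀₀` are μ-admissible for `T₁₀₁`,
`T₁₁₀`. The Tier-6 N2 datum type (t6-p5, T6N2Datum) carries exactly these objects and its
`N2_main` consumes their admissibility as hypotheses (`hfr / h₁₁₁ / h₁₀₀ / hu`, the «EX» residual
class of TARGET-T6 §9). This file discharges that class in the kernel: the objects EXIST for every
CM field of degree 6, by gluing three accepted declarations —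
* `T5CMFrameDictionary.exists_isCMFrame` (degree 6 ⇒ a CM frame exists),
* `exists_isLiuSignElement` (p1, FaceData: every CM type admits a Liu sign element — weak
  approximation at the infinite places, Mathlib `NumberField.InfinitePlace.denseRange_algebraMap_pi`)
  applied to the vertex types `cubeType τ b`, CM types by `T5CubeTypes.isCMType_cubeType`,
* `T5DatumAssembly.lemma_N2_complete` (Lemma N.2 assembled: the similitude `u`).
Nothing here is new mathematics: the file is the existential closure of lines already on the record
(route/T4-B1-p3.md v7 l. 14 / l. 22; route/T5-N2-route-3.md §N2.1(b), §N2.9.2).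

README §8(d): uses an L-value-free non-vanishing device: NO (N2 asserts no non-vanishing; a
pre-02:16Z line of record continued).
-/

namespace Summit.Ventures.HodgeRepro2.T5N2DatumExistence

open Summit.Ventures.HodgeRepro2
open Summit.Ventures.HodgeRepro2.T5CubeTypes
open Summit.Ventures.HodgeRepro2.T5DatumSimilitude

variable {K : Type*} [Field K] [NumberField K] [NumberField.IsCMField K]

/-- Given a CM frame `τ`, the two GENERATING sign elements of §N2.1(b) exist: `e₁` μ-admissible
for the vertex type `T₁₁₁ = cubeType τ t111` and `e₂` μ-admissible for `T₁₀₀ = cubeType τ t100`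
(p1's `exists_isLiuSignElement` on the CM types `isCMType_cubeType`). -/
theorem exists_signElements_of_isCMFrame {τ : Fin 3 → K →+* ℂ} (hτ : IsCMFrame τ) :
    ∃ e₁ e₂ : K, IsLiuSignElement K (cubeType τ t111) e₁ ∧
      IsLiuSignElement K (cubeType τ t100) e₂ := by
  obtain ⟨e₁, h₁⟩ := exists_isLiuSignElement K (T5CubeTypes.isCMType_cubeType hτ t111)
  obtain ⟨e₂, h₂⟩ := exists_isLiuSignElement K (T5CubeTypes.isCMType_cubeType hτ t100)
  exact ⟨e₁, e₂, h₁, h₂⟩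

/-- Given a CM frame `τ`, the WHOLE μ-admissible datum of §N2.1(b) exists: generating sign
elements `e₁` (for `T₁₁₁`), `e₂` (for `T₁₀₀`) and a totally real `u ≠ 0` such that `u * e₁` is
μ-admissible for `T₁₀₁` and `u⁻¹ * e₂` for `T₁₁₀` — the EX residual class `h₁₁₁ / h₁₀₀ / hu` of the
Tier-6 `N2_main`, relative to the frame. -/
theorem exists_muAdmissible_of_isCMFrame {τ : Fin 3 → K →+* ℂ} (hτ : IsCMFrame τ) :
    ∃ e₁ e₂ u : K, IsLiuSignElement K (cubeType τ t111) e₁ ∧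
      IsLiuSignElement K (cubeType τ t100) e₂ ∧ star u = u ∧ u ≠ 0 ∧
      IsLiuSignElement K (cubeType τ t101) (u * e₁) ∧
      IsLiuSignElement K (cubeType τ t110) (u⁻¹ * e₂) := by
  obtain ⟨e₁, e₂, h₁, h₂⟩ := exists_signElements_of_isCMFrame hτ
  obtain ⟨u, hu, hu0, h₃, h₄, -⟩ := T5DatumAssembly.lemma_N2_complete hτ h₁ h₂
  exact ⟨e₁, e₂, u, h₁, h₂, hu, hu0, h₃, h₄⟩

/-- THE EX CLASS OF THE N2 DATUM, absolute form: for every CM field `K` of degree 6 there exist a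
CM frame `τ`, generating sign elements `e₁`, `e₂` and a similitude scalar `u` with all four
μ-admissibilities of §N2.1(b) (`T₁₁₁`, `T₁₀₀`, `T₁₀₁`, `T₁₁₀`) — the hypotheses
`hfr / h₁₁₁ / h₁₀₀ / hu` of the Tier-6 `N2_main` hold for SOME datum over `K`. -/
theorem exists_muAdmissible_frame (h6 : Module.finrank ℚ K = 6) :
    ∃ (τ : Fin 3 → K →+* ℂ) (e₁ e₂ u : K), IsCMFrame τ ∧
      IsLiuSignElement K (cubeType τ t111) e₁ ∧
      IsLiuSignElement K (cubeType τ t100) e₂ ∧ star u = u ∧ u ≠ 0 ∧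
      IsLiuSignElement K (cubeType τ t101) (u * e₁) ∧
      IsLiuSignElement K (cubeType τ t110) (u⁻¹ * e₂) := by
  obtain ⟨τ, hτ⟩ := T5CMFrameDictionary.exists_isCMFrame h6
  obtain ⟨e₁, e₂, u, h₁, h₂, hu, hu0, h₃, h₄⟩ := exists_muAdmissible_of_isCMFrame hτ
  exact ⟨τ, e₁, e₂, u, hτ, h₁, h₂, hu, hu0, h₃, h₄⟩

/-- The EX class with the CM TYPE prescribed: for every CM type `Φ` of a degree-6 CM field there is
a μ-admissible datum whose frame `τ` represents `Φ` (`Set.range τ = Φ`, i.e. `T₁₁₁ = Φ` as the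
vertex `111`) — `T5CMFrameDictionary.exists_isCMFrame_range_eq` composed with the frame-relative
existence. -/
theorem exists_muAdmissible_frame_range_eq (h6 : Module.finrank ℚ K = 6) {Φ : Set (K →+* ℂ)}
    (hΦ : IsCMType K Φ) :
    ∃ (τ : Fin 3 → K →+* ℂ) (e₁ e₂ u : K), IsCMFrame τ ∧ Set.range τ = Φ ∧
      IsLiuSignElement K (cubeType τ t111) e₁ ∧
      IsLiuSignElement K (cubeType τ t100) e₂ ∧ star u = u ∧ u ≠ 0 ∧
      IsLiuSignElement K (cubeType τ t101) (u * e₁) ∧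
      IsLiuSignElement K (cubeType τ t110) (u⁻¹ * e₂) := by
  obtain ⟨τ, hτ, hrange⟩ := T5CMFrameDictionary.exists_isCMFrame_range_eq h6 hΦ
  obtain ⟨e₁, e₂, u, h₁, h₂, hu, hu0, h₃, h₄⟩ := exists_muAdmissible_of_isCMFrame hτ
  exact ⟨τ, e₁, e₂, u, hτ, hrange, h₁, h₂, hu, hu0, h₃, h₄⟩

/-- The full Lemma N.2 package exists (every conjunct of `T5DatumAssembly.lemma_N2_complete`, with
the frame and the generating elements now EXISTENTIAL): for a degree-6 CM field there are `τ`,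
`e₁`, `e₂` with the two generating admissibilities and a `u` satisfying the whole conclusion of
Lemma N.2 assembled — sign pattern of `u` (negative real part exactly at `τ 1` and its conjugate),
the similitude identity on `pairForm`, skew-symmetry of both forms under `star`, and the signature
tables `![(0, 2), (1, 1), (1, 1)]` of both sides. -/
theorem exists_lemma_N2_complete (h6 : Module.finrank ℚ K = 6) :
    ∃ (τ : Fin 3 → K →+* ℂ) (e₁ e₂ : K), IsCMFrame τ ∧
      IsLiuSignElement K (cubeType τ t111) e₁ ∧
      IsLiuSignElement K (cubeType τ t100) e₂ ∧
      ∃ u : K, star u = u ∧ u ≠ 0 ∧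
        IsLiuSignElement K (cubeType τ t101) (u * e₁) ∧
        IsLiuSignElement K (cubeType τ t110) (u⁻¹ * e₂) ∧
        u * e₁ * (u⁻¹ * e₂) = e₁ * e₂ ∧
        (∀ φ : K →+* ℂ, (φ u).re < 0 ↔
          φ = τ 1 ∨ φ = NumberField.ComplexEmbedding.conjugate (τ 1)) ∧
        (∀ v w : K × K, pairForm (u * e₁) (u⁻¹ * e₂) (g0 u v) (g0 u w) =
          u⁻¹ * pairForm e₁ e₂ v w) ∧
        (∀ v w : K × K, star (pairForm e₁ e₂ v w) = -pairForm e₁ e₂ w v) ∧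
        (∀ v w : K × K, star (pairForm (u * e₁) (u⁻¹ * e₂) v w) =
          -pairForm (u * e₁) (u⁻¹ * e₂) w v) ∧
        signature (signVecOf τ e₁) (signVecOf τ e₂) = ![(0, 2), (1, 1), (1, 1)] ∧
        signature (signVecOf τ (u * e₁)) (signVecOf τ (u⁻¹ * e₂)) =
          ![(0, 2), (1, 1), (1, 1)] := by
  obtain ⟨τ, hτ⟩ := T5CMFrameDictionary.exists_isCMFrame h6
  obtain ⟨e₁, e₂, h₁, h₂⟩ := exists_signElements_of_isCMFrame hτ
  exact ⟨τ, e₁, e₂, hτ, h₁, h₂, T5DatumAssembly.lemma_N2_complete hτ h₁ h₂⟩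


/-! ## v2 (append-only): the concrete instance `K7 = ℚ(ζ₇)` (p1's CyclotomicSeven) — the EX class is
inhabited on an actual sextic Galois CM field, for the non-vacuity protocol of README §10.5(ii)(c). -/

open CyclotomicSeven in
/-- NON-VACUITY ON `ℚ(ζ₇)`: the whole μ-admissible datum of §N2.1(b) exists over p1's concrete sextic
Galois CM field `K7 = CyclotomicField 7 ℚ` (`finrank_K7 : Module.finrank ℚ K7 = 6`). -/
theorem exists_muAdmissible_frame_K7 :
    ∃ (τ : Fin 3 → K7 →+* ℂ) (e₁ e₂ u : K7), IsCMFrame τ ∧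
      IsLiuSignElement K7 (cubeType τ t111) e₁ ∧
      IsLiuSignElement K7 (cubeType τ t100) e₂ ∧ star u = u ∧ u ≠ 0 ∧
      IsLiuSignElement K7 (cubeType τ t101) (u * e₁) ∧
      IsLiuSignElement K7 (cubeType τ t110) (u⁻¹ * e₂) :=
  exists_muAdmissible_frame finrank_K7

open CyclotomicSeven in
/-- NON-VACUITY ON `ℚ(ζ₇)`, full form: the whole conclusion of Lemma N.2 assembled is realised on
`K7` by some frame and some generating sign elements. -/
theorem exists_lemma_N2_complete_K7 :
    ∃ (τ : Fin 3 → K7 →+* ℂ) (e₁ e₂ : K7), IsCMFrame τ ∧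
      IsLiuSignElement K7 (cubeType τ t111) e₁ ∧
      IsLiuSignElement K7 (cubeType τ t100) e₂ ∧
      ∃ u : K7, star u = u ∧ u ≠ 0 ∧
        IsLiuSignElement K7 (cubeType τ t101) (u * e₁) ∧
        IsLiuSignElement K7 (cubeType τ t110) (u⁻¹ * e₂) ∧
        u * e₁ * (u⁻¹ * e₂) = e₁ * e₂ ∧
        (∀ φ : K7 →+* ℂ, (φ u).re < 0 ↔
          φ = τ 1 ∨ φ = NumberField.ComplexEmbedding.conjugate (τ 1)) ∧
        (∀ v w : K7 × K7, pairForm (u * e₁) (u⁻¹ * e₂) (g0 u v) (g0 u w) =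
          u⁻¹ * pairForm e₁ e₂ v w) ∧
        (∀ v w : K7 × K7, star (pairForm e₁ e₂ v w) = -pairForm e₁ e₂ w v) ∧
        (∀ v w : K7 × K7, star (pairForm (u * e₁) (u⁻¹ * e₂) v w) =
          -pairForm (u * e₁) (u⁻¹ * e₂) w v) ∧
        signature (signVecOf τ e₁) (signVecOf τ e₂) = ![(0, 2), (1, 1), (1, 1)] ∧
        signature (signVecOf τ (u * e₁)) (signVecOf τ (u⁻¹ * e₂)) =
          ![(0, 2), (1, 1), (1, 1)] :=
  exists_lemma_N2_complete finrank_K7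

end Summit.Ventures.HodgeRepro2.T5N2DatumExistence
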